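import Mathlib.Analysis.LocallyConvex.Separation
import Mathlib.Analysis.Convex.StdSimplex
import Mathlib.Topology.Algebra.Module.FiniteDimension
import Mathlib.Analysis.InnerProductSpace.PiL2
import HarnessLib

/-!
# Von Neumann's min-max theorem for finite two-player zero-sum games

For a payoff matrix `A : I → J → ℝ` on finite strategy sets: if against every mixed strategy `p`
of the row player some pure column `j` achieves payoff `≥ v`, then some mixed column strategy `q`
achieves payoff `≥ v` against every pure row (hence every mixed row strategy) — the nontrivial half
of `max_q min_p = min_p max_q` (von Neumann 1928), proved from the separating-hyperplane theorem
(`geometric_hahn_banach_compact_closed`) in `ℝ^I`: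

* `MinMax.exists_mixed_of_forall_mixed` — the non-strict form above;
* `MinMax.exists_mixed_of_forall_mixed_lt` — the strict form ("payoff `> v`" on both sides), by
  compactness of the simplex (this is the "Min-Max Principle" invoked in Goldreich–Nisan–Wigderson,
  *On Yao's XOR-Lemma*, App. A, Claim 12.1, and Goldreich 2008, Claim 7.21.1).

Mathlib has the simplex (`stdSimplex`, compact and convex) and the separation theorems but no
min-max theorem (searched: `minimax`, `zeroSum`, `saddle`).

## References

* J. von Neumann, *Zur Theorie der Gesellschaftsspiele*, Math. Ann. 100 (1928) 295–320.
* O. Goldreich, *Computational Complexity: A Conceptual Perspective*, CUP 2008, proof of Claim 7.21.1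
  ("The Min-Max Principle (cf. von Neumann)").
-/

noncomputable section

namespace Literature.Analysis.Convex

open Finset

namespace MinMax

variable {I J : Type*} [Fintype I] [Fintype J] [DecidableEq I] [DecidableEq J]

/-- The payoff vector of a mixed column strategy: row `i` gets `Σ_j q_j A i j`. [folklore] -/
def payoffVec (A : I → J → ℝ) (q : J → ℝ) : I → ℝ := fun i => ∑ j, q j * A i j

/-- The payoff vector is linear in the column strategy. [folklore] -/
def payoffLin (A : I → J → ℝ) : (J → ℝ) →ₗ[ℝ] (I → ℝ) where
  toFun := payoffVec A
  map_add' q q' := by funext i; simp [payoffVec, add_mul, sum_add_distrib]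
  map_smul' c q := by funext i; simp [payoffVec, mul_sum, mul_assoc]

/-- A continuous linear functional on `ℝ^I` is `z ↦ Σ_i z_i · f(e_i)`. [folklore] -/
theorem dual_apply_eq_sum (f : StrongDual ℝ (I → ℝ)) (z : I → ℝ) : f z = ∑ i, z i * f (Pi.single i 1) := by
  conv_lhs => rw [show z = ∑ i, z i • (Pi.single i (1 : ℝ) : I → ℝ) by
    funext k; simp [Finset.sum_apply, Pi.single_apply]]
  rw [map_sum]
  simp [smul_eq_mul]

/-- **Min-max, non-strict form.** If every mixed row strategy `p` admits a pure column `j` with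
`v ≤ Σ_i p_i A i j`, then some mixed column strategy `q` has `v ≤ Σ_j q_j A i j` for every row `i`.
[cite: vonNeumann1928] -/
theorem exists_mixed_of_forall_mixed [Nonempty J] (A : I → J → ℝ) (v : ℝ)
    (h : ∀ p : I → ℝ, (∀ i, 0 ≤ p i) → ∑ i, p i = 1 → ∃ j, v ≤ ∑ i, p i * A i j) :
    ∃ q : J → ℝ, (∀ j, 0 ≤ q j) ∧ ∑ j, q j = 1 ∧ ∀ i, v ≤ ∑ j, q j * A i j := by
  classical
  -- the achievable payoff vectors `S` and the target orthant `T`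
  set S : Set (I → ℝ) := payoffLin A '' stdSimplex ℝ J with hS
  set T : Set (I → ℝ) := {z | ∀ i, v ≤ z i} with hT
  by_cases hST : (S ∩ T).Nonempty
  · obtain ⟨z, ⟨q, hq, rfl⟩, hz⟩ := hST
    exact ⟨q, hq.1, hq.2, fun i => hz i⟩
  exfalso
  have hSc : Convex ℝ S := (convex_stdSimplex ℝ J).is_linear_image (payoffLin A).isLinear
  have hSk : IsCompact S := (isCompact_stdSimplex ℝ J).image (payoffLin A).continuous_of_finiteDimensional
  have hTc : Convex ℝ T := by
    intro z hz z' hz' a b ha hb hab i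
    have h1 := mul_le_mul_of_nonneg_left (hz i) ha
    have h2 := mul_le_mul_of_nonneg_left (hz' i) hb
    have h3 : a * v + b * v = v := by rw [← add_mul, hab, one_mul]
    simp only [Pi.add_apply, Pi.smul_apply, smul_eq_mul]
    linarith
  have hTcl : IsClosed T := by
    have : T = ⋂ i, {z : I → ℝ | v ≤ z i} := by ext z; simp [hT]
    rw [this]
    exact isClosed_iInter fun i => isClosed_le continuous_const (continuous_apply i)
  have hdisj : Disjoint S T := Set.disjoint_iff_inter_eq_empty.2 (Set.not_nonempty_iff_eq_empty.1 hST)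
  obtain ⟨f, u, w, hfS, huw, hfT⟩ := geometric_hahn_banach_compact_closed hSc hSk hTc hTcl hdisj
  -- the functional as a weight vector
  set p : I → ℝ := fun i => f (Pi.single i 1) with hp
  have hf : ∀ z, f z = ∑ i, z i * p i := dual_apply_eq_sum f
  -- weights are nonnegative: push `v·1 + λ e_i ∈ T` to infinity
  have hvT : (fun _ : I => v) ∈ T := fun i => le_rfl
  have hp0 : ∀ i, 0 ≤ p i := by
    intro i
    by_contra hneg
    push Not at hneg
    -- `f (v·1 + λ e_i) = f(v·1) + λ p_i → -∞`
    set c := f (fun _ : I => v) with hc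
    have hmem : ∀ L : ℝ, 0 ≤ L → (fun k : I => v + L * (Pi.single i (1:ℝ) : I → ℝ) k) ∈ T := by
      intro L hL k; simp only [Pi.single_apply]; split_ifs <;> nlinarith
    have hval : ∀ L : ℝ, f (fun k : I => v + L * (Pi.single i (1:ℝ) : I → ℝ) k) = c + L * p i := by
      intro L
      rw [hf, hc, hf]
      simp only [add_mul, sum_add_distrib]
      congr 1
      rw [Finset.sum_eq_single i (fun k _ hk => by simp [hk]) (by simp)]
      simp
    have hpi : 0 < -p i := by linarith
    have hcw : w < c := by have := hfT _ hvT; rwa [← hc] at this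
    have := hfT _ (hmem ((c - w) / (-p i) + 1) (by positivity))
    rw [hval] at this
    have hne : p i ≠ 0 := hneg.ne
    have hid : ((c - w) / (-p i) + 1) * p i = -(c - w) + p i := by
      field_simp
    rw [hid] at this
    linarith
  -- weights are not all zero
  have hsum : 0 < ∑ i, p i := by
    rcases (sum_nonneg fun i _ => hp0 i).eq_or_lt with h0 | h0
    · exfalso
      have hpz : ∀ i, p i = 0 := fun i => (sum_eq_zero_iff_of_nonneg fun i _ => hp0 i).1 h0.symm i (mem_univ i)
      have hf0 : ∀ z, f z = 0 := fun z => by rw [hf]; simp [hpz]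
      obtain ⟨j⟩ := ‹Nonempty J›
      have hsS : payoffLin A (Pi.single j 1) ∈ S := ⟨Pi.single j 1, ⟨fun k => by
        simp only [Pi.single_apply]; split_ifs <;> norm_num, by simp⟩, rfl⟩
      have h1 := hfS _ hsS
      have h2 := hfT _ hvT
      rw [hf0] at h1 h2
      linarith
    · exact h0
  -- the normalized weights are a mixed row strategy; its best pure column contradicts the separation
  obtain ⟨j, hj⟩ := h (fun i => p i / ∑ i, p i) (fun i => div_nonneg (hp0 i) hsum.le)
    (by rw [← sum_div, div_self hsum.ne'])
  have hsS : payoffLin A (Pi.single j 1) ∈ S := ⟨Pi.single j 1, ⟨fun k => by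
    simp only [Pi.single_apply]; split_ifs <;> norm_num, by simp⟩, rfl⟩
  have h1 := hfS _ hsS
  have h2 := hfT _ hvT
  rw [hf] at h1 h2
  have hcol : ∀ i, payoffLin A (Pi.single j (1:ℝ)) i = A i j := fun i => by
    simp [payoffLin, payoffVec, Pi.single_apply]
  simp only [hcol] at h1
  -- `Σ_i A i j p_i < u < w < v Σ p_i`, while `v ≤ Σ_i (p_i/Σp) A i j`
  rw [← mul_sum] at h2
  have h3 : v * ∑ i, p i ≤ ∑ i, A i j * p i := by
    have := mul_le_mul_of_nonneg_right hj hsum.le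
    rw [sum_mul] at this
    refine this.trans (le_of_eq (sum_congr rfl fun i _ => ?_))
    field_simp
  linarith

/-- **Min-max, strict form (the "Min-Max Principle").** If every mixed row strategy admits a pure
column with payoff `> v`, then some mixed column strategy has payoff `> v` against every row.
[cite: vonNeumann1928] -/
theorem exists_mixed_of_forall_mixed_lt [Nonempty J] (A : I → J → ℝ) (v : ℝ)
    (h : ∀ p : I → ℝ, (∀ i, 0 ≤ p i) → ∑ i, p i = 1 → ∃ j, v < ∑ i, p i * A i j) :
    ∃ q : J → ℝ, (∀ j, 0 ≤ q j) ∧ ∑ j, q j = 1 ∧ ∀ i, v < ∑ j, q j * A i j := by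
  classical
  rcases isEmpty_or_nonempty I with hI | hI
  · obtain ⟨j⟩ := ‹Nonempty J›
    exact ⟨Pi.single j 1, fun k => by simp only [Pi.single_apply]; split_ifs <;> norm_num, by simp, fun i => (hI.false i).elim⟩
  -- the best pure-column payoff `g(p) = max_j Σ_i p_i A i j` is continuous and `> v` on the compact simplex
  set F : J → (I → ℝ) → ℝ := fun j p => ∑ i, p i * A i j with hF
  set g : (I → ℝ) → ℝ := fun p => Finset.univ.sup' Finset.univ_nonempty fun j => F j p with hg
  have hgc : Continuous g := by
    have hc : Continuous (Finset.univ.sup' Finset.univ_nonempty F) :=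
      Continuous.finset_sup' _ fun j _ => continuous_finsetSum _ fun i _ => (continuous_apply i).mul continuous_const
    convert hc using 1
    funext p
    simp [hg, Finset.sup'_apply]
  obtain ⟨p₀, hp₀, hmin⟩ := (isCompact_stdSimplex ℝ I).exists_isMinOn
    ⟨fun i => (Fintype.card I : ℝ)⁻¹, ⟨fun i => by positivity, by simp [Finset.card_univ]⟩⟩ hgc.continuousOn
  have hgp₀ : v < g p₀ := by
    obtain ⟨j, hj⟩ := h p₀ hp₀.1 hp₀.2
    exact lt_of_lt_of_le hj (Finset.le_sup' (fun j => ∑ i, p₀ i * A i j) (mem_univ j))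
  -- apply the non-strict form at level `g p₀`
  obtain ⟨q, hq0, hq1, hq⟩ := exists_mixed_of_forall_mixed A (g p₀) fun p hp hp1 => by
    have hle : g p₀ ≤ g p := hmin ⟨hp, hp1⟩
    obtain ⟨j, -, hj⟩ := Finset.exists_mem_eq_sup' Finset.univ_nonempty fun j => ∑ i, p i * A i j
    exact ⟨j, by rw [← hj]; exact hle⟩
  exact ⟨q, hq0, hq1, fun i => lt_of_lt_of_le hgp₀ (hq i)⟩

end MinMax

end Literature.Analysis.Convex

end
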